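import Summits.CriticalPhenomena.PercolationContinuityZ3.Theorems.Transplant.KNCells2KitResidues
import Summits.CriticalPhenomena.PercolationContinuityZ3.Theorems.Transplant.KNCells2KitAtRun
import HarnessLib

/-!
# The named residues of the (D) node, RUN-RESTRICTED form (lead V67 / p5-g3 15:15Z): `FaceOblR`, `ReachOblR` — the per-probe bodies
# `FaceOblAt` / `ReachOblAt` (p221529) owed only at histories the scheme PRODUCES (`IsRun₂ h`), at the chosen edge, after a valid history —
# the weakenings from the chosen form, and `kitAtRun_of_oblR` (⟹ p5-g3's `KitAtRun`)

builds on p205010 (kernel theorem, internal audit signed; external expert review pending) — nothing in this file uses p205010.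
Lane `prim-bschramm-*`, seat `prim-bschramm-stmt` (gen 5); helper file (`--supports stmt-CriticalPhenomena-4575`).

WHY (refuter p5-g3 15:15Z, lead ruling 15:15:37Z): `Valid₂.cover` lets an ARBITRARY valid history carry explored, pinned-open junk right
beside the fresh between-box of the probe, where the rim excess `hexc` of the corridor chain is false; along a RUN the explored region is
the root cube plus the regions of earlier chosen valid probes (`RunInv₂.V_cases`), which planar separation keeps fibre-deep.  So the
corridor (and, harmlessly, the face) obligations are re-quantified over run histories: one more premise `S.IsRun₂ G h`.  The root obligation
has no history and is unchanged (`RootObl` / `RootOblT`).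
* `KSchA.FaceOblR X S FD Δ' δ₂`, `KSchA.ReachOblR X S FD Δ' δ` — `∀ h e, S.IsRun₂ G h → choice = some e → S.Valid₂ G h e → …`;
* `faceOblR_of_faceOblC`, `reachOblR_of_reachOblC` (the chosen form implies the run form);
* **`kitAtRun_of_oblR`** — `δc ≤ δ`, the step / chain properties at `S.p` (U2), `RootOblT`, `FaceOblR`, `ReachOblR` ⟹ `KitAtRun (X □ ℤ²) S FD δ₂ ε''`.
[cite: KozmaNitzan2024, §4 (30), (32) (pp. 27–28), Lemma 10 (p. 17), Lemmas 11–12 (pp. 22–25), p. 30 (Steps III–IV)]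
-/

noncomputable section

open MeasureTheory ProbabilityTheory
open scoped ENNReal Classical

namespace Summit.CriticalPhenomena.PercolationContinuityZ3.Theorems

namespace Transplant

namespace KNCells

open Literature.Probability.Percolation Literature.Probability.LatticeModels SimpleGraph GadgetSystem ProbeHistory HSiteScheme Contour
open BoxProdZ2

namespace KSchA

variable {W : Type} [DecidableEq W] [Countable W] (X : SimpleGraph W) [X.LocallyFinite]
variable {A : Type*}

/-! ## §1 The run-restricted residues -/

/-- **The face obligations, run-restricted form**: `FaceOblAt` for every RUN history whose chosen candidate is `e`, valid, every onward
direction, every `j < K` and every `o`, at the history anchors `(aOf₁, aOf₂)`. [cite: KozmaNitzan2024, §4 p. 30 (Steps III–IV)] -/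
def FaceOblR (S : KSchA (W × Site 2) A) (FD : FaceData (W × Site 2) A) (Δ' : ℕ) (δ₂ : ℝ) : Prop :=
  ∀ h e, S.IsRun₂ (X □ zdGraph 2) h → (S.astOf₂ (X □ zdGraph 2) h).st.choice = some e → S.Valid₂ (X □ zdGraph 2) h e →
    ∀ du ∈ S.onward (X □ zdGraph 2) h (tgt e), ∀ j < S.Γ.K, ∀ o : Finset (Sym2 (W × Site 2)),
      FaceOblAt X S FD Δ' δ₂ h e (S.aOf₁ (X □ zdGraph 2) h e) (S.aOf₂ (X □ zdGraph 2) h e) du j o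

/-- **The corridor obligations, run-restricted form**: `ReachOblAt` for every RUN history whose chosen candidate is `e`, valid, and every
onward direction, at `a' = aOf₂`. [cite: KozmaNitzan2024, §4 p. 30 (Step IV), Lemma 12 (pp. 23–25)] -/
def ReachOblR (S : KSchA (W × Site 2) A) (FD : FaceData (W × Site 2) A) (Δ' : ℕ) (δ : ℝ) : Prop :=
  ∀ h e, S.IsRun₂ (X □ zdGraph 2) h → (S.astOf₂ (X □ zdGraph 2) h).st.choice = some e → S.Valid₂ (X □ zdGraph 2) h e →
    ∀ du ∈ S.onward (X □ zdGraph 2) h (tgt e), ReachOblAt X S FD Δ' δ h e (S.aOf₂ (X □ zdGraph 2) h e) du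

variable {X}
variable {S : KSchA (W × Site 2) A} {FD : FaceData (W × Site 2) A}

omit [Countable W] in
/-- The chosen form implies the run form (faces). [folklore] -/
theorem faceOblR_of_faceOblC {Δ' : ℕ} {δ₂ : ℝ} (h : FaceOblC X S FD Δ' δ₂) : FaceOblR X S FD Δ' δ₂ :=
  fun hh e _ hc hV => h hh e hc hV

omit [Countable W] in
/-- The chosen form implies the run form (corridors). [folklore] -/
theorem reachOblR_of_reachOblC {Δ' : ℕ} {δ : ℝ} (h : ReachOblC X S FD Δ' δ) : ReachOblR X S FD Δ' δ :=
  fun hh e _ hc hV => h hh e hc hV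

/-! ## §2 The run-restricted obligations from the residues -/

/-- **The run-restricted obligations from the named residues**: `δc ≤ δ`, the one-step property at `(δ₂ ↦ δc/2)`, the chain property of
length `nLast + 1` at `(δ ↦ ε'')` and the chain properties of every length at `(δr n ↦ δc)` for the windows of `X` at the parameter `S.p`
(U2: `apply_step_tube_UP`, `chain_edge_tube_UP`), `RootOblT … δr`, `FaceOblR … δ₂` and `ReachOblR … δ` ⟹ p5-g3's
`KitAtRun (X □ ℤ²) S FD δ₂ ε''`. [cite: KozmaNitzan2024, §4 (30), (32), Lemmas 10–12] -/
theorem kitAtRun_of_oblR {Δ' : ℕ} {δ δ₂ ε'' : ℝ} {δr : ℕ → ℝ} (hδc : S.δc ≤ δ)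
    (hstep : ∀ (π : Finset W) (Wg : Sym2 (W × Site 2) → unitInterval) (s : KNLevels.TStep (tubeGraph X π)), s.KitsAt Wg S.p Δ' δ₂ →
      1 - δ₂ < (prodBernoulli Wg).real s.L.reachB → 1 - S.δc / 2 < (prodBernoulli Wg).real (⋃ t ∈ s.T, openConn s.L.o t))
    (hchain : ∀ (π : Finset W) (Wg : Sym2 (W × Site 2) → unitInterval)
      (s : Fin (ChainPlanar.Sched.nLast + 1) → KNLevels.TStep (tubeGraph X π))
      (T' : Fin (ChainPlanar.Sched.nLast + 1) → Finset (W × Site 2)) (η : ℝ),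
      (∀ i, (s i).L.o = (s 0).L.o) →
      (∀ i : Fin ChainPlanar.Sched.nLast, T' (Fin.castSucc i) ⊆ (s i.succ).L.X 0) →
      (∀ i, T' i ⊆ (s i).T) →
      (∀ i, (s i).KitsAt Wg S.p Δ' δ) →
      η ≤ δ / 2 →
      (∀ i, (prodBernoulli Wg).real (⋃ t ∈ (s i).T \ T' i, openConn (s 0).L.o t) ≤ η) →
      1 - δ < (prodBernoulli Wg).real (s 0).L.reachB →
        1 - ε'' < (prodBernoulli Wg).real (⋃ t ∈ T' (Fin.last ChainPlanar.Sched.nLast), openConn (s 0).L.o t))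
    (hchainr : ∀ (n : ℕ) (π : Finset W) (Wg : Sym2 (W × Site 2) → unitInterval) (s : Fin (n + 1) → KNLevels.TStep (tubeGraph X π))
      (T' : Fin (n + 1) → Finset (W × Site 2)) (η : ℝ),
      (∀ i : Fin (n + 1), (s i).L.o = (s 0).L.o) →
      (∀ i : Fin n, T' (Fin.castSucc i) ⊆ (s i.succ).L.X 0) →
      (∀ i : Fin (n + 1), T' i ⊆ (s i).T) →
      (∀ i : Fin (n + 1), (s i).KitsAt Wg S.p Δ' (δr n)) →
      η ≤ δr n / 2 →
      (∀ i : Fin (n + 1), (prodBernoulli Wg).real (⋃ t ∈ (s i).T \ T' i, openConn (s 0).L.o t) ≤ η) →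
      1 - δr n < (prodBernoulli Wg).real (s 0).L.reachB →
        1 - S.δc < (prodBernoulli Wg).real (⋃ t ∈ T' (Fin.last n), openConn (s 0).L.o t))
    (hQ0 : RootOblT X S Δ' δr) (hface : FaceOblR X S FD Δ' δ₂) (hreach : ReachOblR X S FD Δ' δ) :
    KitAtRun (X □ zdGraph 2) S FD δ₂ ε'' := by
  refine And.intro (rootObl_of_rootOblT hchainr hQ0) (And.intro ?_ ?_)
  · intro h e hrun hc hV du hdu j hj o hsrc
    exact cond_of_faceOblAt hstep (hface h e hrun hc hV du hdu j hj o) hsrc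
  · intro h e hrun hc hV du hdu
    exact reach_of_reachOblAt hV hδc hchain (hreach h e hrun hc hV du hdu)

end KSchA

end KNCells

end Transplant

end Summit.CriticalPhenomena.PercolationContinuityZ3.Theorems

end
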